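import Summits.CriticalPhenomena.CardyFormulaZ2.Theorems.CardyUSTContinuationKirchhoffExtremalLengthG02Cross1
import Literature.Probability.RandomPlanarGeometry.ExteriorULC
import Mathlib.Analysis.Convex.PathConnected

/-!
# Exterior connections through the closing curves of a crosscut (G02 discretisation)

Support file for `KirchhoffExtremalLength` (route CardyUSTContinuation of `CardyFormulaZ2`, item
stmt-CriticalPhenomena-11234), towards the upper half of `G02ModulusConvergence` (`…Defs.lean`).
In the identification of the flux across the crosscut with the current out of `A_δ`
([GP19] §3, `exists_exits_flux_eq` of the tree for the Georgakopoulos–Panagiotis graph), the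
loop through the two exits at the ends of the crosscut is closed by a lattice walk carrying no
flux. For `Ω_δ = discreteDomainGraph Ω δ` such walks are shadows of EXTERIOR paths
(`exists_fluxFree_walk`), and this file supplies the exterior path: two exterior points next to
the end points `q_t = E_t(1)`, `q_b = E_b(1)` of the exterior closing curves `E_t`, `M`, `E_b`
(`SquareTiling.exists_exterior_curves`) are joined in the exterior, inside the union of the
closing curves and two small balls about `q_t`, `q_b` (uniform local connectedness of the
exterior at `q_t`, `q_b`, then along the curves). Also: the squares of the lattice column
through the straight middle piece of `Γ_V` touch that piece and the ball `B̄(c₀, r)`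
(`column_touch`).
-/

noncomputable section

namespace Summit.CriticalPhenomena.CardyFormulaZ2.Theorems

namespace KirchhoffSlope

open Set Metric Filter Topology
open Literature.Probability Literature.Probability.LatticeModels
open Literature.Probability.LatticeModels.SquareTiling (closedSq upRun mem_support_upRun mem_closedSq_col)
open Literature.Probability.RandomPlanarGeometry

/-- A curve continuous on `[a, b]` with values in `F` joins `γ a` to `γ b` inside `F`. [folklore] -/
theorem joinedIn_of_continuousOn_Icc {γ : ℝ → ℂ} {a b : ℝ} (hab : a ≤ b) (hγ : ContinuousOn γ (Icc a b))
    {F : Set ℂ} (hF : ∀ t ∈ Icc a b, γ t ∈ F) : JoinedIn F (γ a) (γ b) := by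
  have hpc : IsPathConnected (γ '' Icc a b) :=
    ((convex_Icc a b).isPathConnected (nonempty_Icc.2 hab)).image' hγ
  refine (hpc.joinedIn _ (mem_image_of_mem γ (left_mem_Icc.2 hab)) _ (mem_image_of_mem γ (right_mem_Icc.2 hab))).mono ?_
  rintro _ ⟨t, ht, rfl⟩
  exact hF t ht

/-- A point of a curve continuous on `[1, 2]`, exterior on `(1, 2]`, just after its start: for
every `ε > 0` there is `t₁ ∈ (1, 2]` with `E t` exterior and within `ε` of `E 1` for all
`t ∈ (1, t₁]`. [folklore] -/
theorem exists_start_param {Ω : Set ℂ} {E : ℝ → ℂ} (hEc : ContinuousOn E (Icc 1 2))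
    (hE : ∀ t ∈ Ioc (1 : ℝ) 2, E t ∈ (closure Ω)ᶜ) {ε : ℝ} (hε : 0 < ε) :
    ∃ t₁ ∈ Ioc (1 : ℝ) 2, ∀ t ∈ Ioc 1 t₁, E t ∈ (closure Ω)ᶜ ∧ dist (E t) (E 1) < ε := by
  have h1 : (1 : ℝ) ∈ Icc (1 : ℝ) 2 := left_mem_Icc.2 (by norm_num)
  obtain ⟨d, hd, hdc⟩ := Metric.continuousWithinAt_iff.1 (hEc 1 h1) ε hε
  refine ⟨min (1 + d / 2) 2, ⟨lt_min (by linarith) (by norm_num), min_le_right _ _⟩, fun t ht => ?_⟩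
  have ht2 : t ≤ 2 := ht.2.trans (min_le_right _ _)
  have htd : t ≤ 1 + d / 2 := ht.2.trans (min_le_left _ _)
  refine ⟨hE t ⟨ht.1, ht2⟩, hdc ⟨ht.1.le, ht2⟩ ?_⟩
  rw [Real.dist_eq, abs_of_pos (by linarith [ht.1])]
  linarith

/-- **Exterior connections through the closing curves.** Let `E_t`, `M`, `E_b` be the exterior
closing curves of a crosscut (`E_t`, `E_b` continuous on `[1,2]`, exterior on `(1,2]`, `M`
continuous and exterior on `[0,1]`, `M 0 = E_t 2`, `M 1 = E_b 2`), and `r' > 0`. Then there is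
`θ > 0` such that any exterior point within `θ` of `q_t = E_t 1` and any exterior point within `θ`
of `q_b = E_b 1` are joined by an exterior path inside
`E_t([1,2]) ∪ M([0,1]) ∪ E_b([1,2]) ∪ B(q_t, r') ∪ B(q_b, r')`. [folklore] -/
theorem exterior_joinedIn_of_closing_curves (R : ConformalRectangle) {Et Eb M : ℝ → ℂ}
    (hEtc : ContinuousOn Et (Icc 1 2)) (hEbc : ContinuousOn Eb (Icc 1 2)) (hMc : ContinuousOn M (Icc 0 1))
    (hEt : ∀ t ∈ Ioc (1 : ℝ) 2, Et t ∈ (closure R.carrier)ᶜ)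
    (hEb : ∀ t ∈ Ioc (1 : ℝ) 2, Eb t ∈ (closure R.carrier)ᶜ) (hM : ∀ s ∈ Icc (0 : ℝ) 1, M s ∈ (closure R.carrier)ᶜ)
    (hM0 : M 0 = Et 2) (hM1 : M 1 = Eb 2) {r' : ℝ} (hr' : 0 < r') :
    ∃ θ > 0, ∀ e₁ e₂ : ℂ, e₁ ∈ (closure R.carrier)ᶜ → e₂ ∈ (closure R.carrier)ᶜ →
      dist e₁ (Et 1) < θ → dist e₂ (Eb 1) < θ →
      JoinedIn ((closure R.carrier)ᶜ ∩
        (Et '' Icc 1 2 ∪ M '' Icc 0 1 ∪ Eb '' Icc 1 2 ∪ ball (Et 1) r' ∪ ball (Eb 1) r')) e₁ e₂ := by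
  set X : Set ℂ := (closure R.carrier)ᶜ with hX
  set S : Set ℂ := Et '' Icc 1 2 ∪ M '' Icc 0 1 ∪ Eb '' Icc 1 2 ∪ ball (Et 1) r' ∪ ball (Eb 1) r' with hS
  -- uniform local connectedness of the exterior, at scale `r' / 2`
  obtain ⟨ηu, hηu, hulc⟩ := R.toJordanDomain.exterior_joinedIn_of_dist_lt (ε := r' / 2) (by positivity)
  -- points of the curves just after their starts
  obtain ⟨t₁, ht₁, Ht₁⟩ := exists_start_param hEtc hEt (ε := min (ηu / 2) (r' / 2)) (by positivity)
  obtain ⟨t₂, ht₂, Ht₂⟩ := exists_start_param hEbc hEb (ε := min (ηu / 2) (r' / 2)) (by positivity)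
  obtain ⟨hEt₁, hdt₁⟩ := Ht₁ t₁ ⟨ht₁.1, le_rfl⟩
  obtain ⟨hEt₂, hdt₂⟩ := Ht₂ t₂ ⟨ht₂.1, le_rfl⟩
  refine ⟨min (ηu / 2) (r' / 2), by positivity, fun e₁ e₂ he₁ he₂ hd₁ hd₂ => ?_⟩
  have hm1 : min (ηu / 2) (r' / 2) ≤ ηu / 2 := min_le_left _ _
  have hm2 : min (ηu / 2) (r' / 2) ≤ r' / 2 := min_le_right _ _
  -- (1) `e₁ → Et t₁` by ULC inside `B(q_t, r')`
  have j1 : JoinedIn (X ∩ S) e₁ (Et t₁) := by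
    have hd : dist e₁ (Et t₁) < ηu := by
      have := dist_triangle e₁ (Et 1) (Et t₁)
      rw [dist_comm (Et 1) (Et t₁)] at this
      linarith
    refine (hulc e₁ he₁ (Et t₁) hEt₁ hd).mono (inter_subset_inter_right _ fun z hz => ?_)
    refine Or.inl (Or.inr ?_)
    rw [Metric.mem_ball] at hz ⊢
    linarith [dist_triangle z e₁ (Et 1)]
  -- (2) `Et t₁ → Et 2` along `E_t`
  have j2 : JoinedIn (X ∩ S) (Et t₁) (Et 2) := by
    refine joinedIn_of_continuousOn_Icc ht₁.2 (hEtc.mono (Icc_subset_Icc ht₁.1.le le_rfl)) fun t ht => ⟨?_, ?_⟩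
    · exact hEt t ⟨ht₁.1.trans_le ht.1, ht.2⟩
    · exact Or.inl (Or.inl (Or.inl (Or.inl ⟨t, ⟨ht₁.1.le.trans ht.1, ht.2⟩, rfl⟩)))
  -- (3) `Et 2 = M 0 → M 1 = Eb 2` along `M`
  have j3 : JoinedIn (X ∩ S) (Et 2) (Eb 2) := by
    rw [← hM0, ← hM1]
    refine joinedIn_of_continuousOn_Icc zero_le_one hMc fun s hs => ⟨hM s hs, ?_⟩
    exact Or.inl (Or.inl (Or.inl (Or.inr ⟨s, hs, rfl⟩)))
  -- (4) `Eb 2 → Eb t₂` along `E_b`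
  have j4 : JoinedIn (X ∩ S) (Eb 2) (Eb t₂) := by
    refine (joinedIn_of_continuousOn_Icc (F := X ∩ S) ht₂.2 (hEbc.mono (Icc_subset_Icc ht₂.1.le le_rfl)) fun t ht => ?_).symm
    exact ⟨hEb t ⟨ht₂.1.trans_le ht.1, ht.2⟩, Or.inl (Or.inl (Or.inr ⟨t, ⟨ht₂.1.le.trans ht.1, ht.2⟩, rfl⟩))⟩
  -- (5) `Eb t₂ → e₂` by ULC inside `B(q_b, r')`
  have j5 : JoinedIn (X ∩ S) (Eb t₂) e₂ := by
    have hd : dist e₂ (Eb t₂) < ηu := by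
      have := dist_triangle e₂ (Eb 1) (Eb t₂)
      rw [dist_comm (Eb 1) (Eb t₂)] at this
      linarith
    refine ((hulc e₂ he₂ (Eb t₂) hEt₂ hd).mono (inter_subset_inter_right _ fun z hz => ?_)).symm
    refine Or.inr ?_
    rw [Metric.mem_ball] at hz ⊢
    linarith [dist_triangle z e₂ (Eb 1)]
  exact ((j1.trans j2).trans (j3.trans j4)).trans j5

/-! ### The column of the cross -/

/-- **The squares of the column touch the middle piece and the ball.** For the cross data
(`|xs - c₀.re| < r/5`, mesh `16δ < r`), every square of the lattice column from the square of
`Q_v⁻ = (xs, c₀.im - r/2)` up to the square of `Q_v⁺ = (xs, c₀.im + r/2)` contains a point of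
the closed ball `B̄(c₀, r)` and a point of the segment `[Q_v⁻, Q_v⁺]`. [folklore] -/
theorem column_touch {δ : ℝ} (hδ : 0 < δ) {c₀ : ℂ} {r xs : ℝ} (hr : 0 < r) (hxs : |xs - c₀.re| < r / 5) (hδr : 16 * δ < r) :
    ∀ q ∈ (upRun (![⌊xs / δ⌋, ⌊(c₀.im - r / 2) / δ⌋] : Site 2)
        (⌊(c₀.im + r / 2) / δ⌋ - ⌊(c₀.im - r / 2) / δ⌋).toNat).support,
      (∃ w ∈ closedBall c₀ r, w ∈ closedSq δ q) ∧
      (∃ x ∈ segment ℝ (⟨xs, c₀.im - r / 2⟩ : ℂ) ⟨xs, c₀.im + r / 2⟩, x ∈ closedSq δ q) := by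
  set Xs : ℤ := ⌊xs / δ⌋ with hXs
  set Ym : ℤ := ⌊(c₀.im - r / 2) / δ⌋ with hYm
  set Yp : ℤ := ⌊(c₀.im + r / 2) / δ⌋ with hYp
  have hYmp : Ym ≤ Yp := Int.floor_le_floor (div_le_div_of_nonneg_right (by linarith) hδ.le)
  set k : ℕ := (Yp - Ym).toNat with hk
  have hkz : (k : ℤ) = Yp - Ym := Int.toNat_of_nonneg (by omega)
  set Cm : Site 2 := ![Xs, Ym] with hCm
  have hlo : c₀.im - r / 2 < ((Ym : ℝ) + 1) * δ := by
    have := Int.lt_floor_add_one ((c₀.im - r / 2) / δ); rwa [div_lt_iff₀ hδ] at this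
  have hlo' : (Ym : ℝ) * δ ≤ c₀.im - r / 2 := by
    have := Int.floor_le ((c₀.im - r / 2) / δ); rwa [le_div_iff₀ hδ] at this
  have hhi : (Yp : ℝ) * δ ≤ c₀.im + r / 2 := by
    have := Int.floor_le ((c₀.im + r / 2) / δ); rwa [le_div_iff₀ hδ] at this
  have hxs' := abs_lt.1 hxs
  intro q hq
  rw [mem_support_upRun] at hq
  obtain ⟨hq0, hq1, hq2⟩ := hq
  have hqeq : q = ![Xs, q 1] := by ext i; fin_cases i <;> simp [hq0, hCm]
  have hy1 : Ym ≤ q 1 := by simpa [hCm] using hq1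
  have hy2 : q 1 ≤ Yp := by have := hq2; simp [hCm] at this; omega
  have hyy1 : (Ym : ℝ) * δ ≤ (q 1 : ℝ) * δ := mul_le_mul_of_nonneg_right (by exact_mod_cast hy1) hδ.le
  have hyy2 : (q 1 : ℝ) * δ ≤ (Yp : ℝ) * δ := mul_le_mul_of_nonneg_right (by exact_mod_cast hy2) hδ.le
  have hx := mem_closedSq_col hδ xs (q 1)
  rw [← hXs, ← hqeq] at hx
  constructor
  · -- the point `(xs, (q 1 + 1/2) δ)` of the ball
    refine ⟨_, ?_, hx⟩
    have hb : |((q 1 : ℝ) + 1 / 2) * δ - c₀.im| ≤ r / 2 + δ := by rw [abs_le]; constructor <;> linarith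
    have hb2 : (((q 1 : ℝ) + 1 / 2) * δ - c₀.im) ^ 2 ≤ (r / 2 + δ) ^ 2 := by
      rw [← sq_abs]; exact pow_le_pow_left₀ (abs_nonneg _) hb 2
    have ha2 : (xs - c₀.re) ^ 2 ≤ (r / 5) ^ 2 := by
      rw [← sq_abs]; exact pow_le_pow_left₀ (abs_nonneg _) hxs.le 2
    have hsum : (r / 5) ^ 2 + (r / 2 + δ) ^ 2 ≤ r ^ 2 := by nlinarith
    rw [Metric.mem_closedBall, Complex.dist_eq, Complex.norm_def, Real.sqrt_le_left hr.le, Complex.normSq_apply]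
    have e1 : ((⟨xs, ((q 1 : ℝ) + 1 / 2) * δ⟩ : ℂ) - c₀).re = xs - c₀.re := by simp
    have e2 : ((⟨xs, ((q 1 : ℝ) + 1 / 2) * δ⟩ : ℂ) - c₀).im = ((q 1 : ℝ) + 1 / 2) * δ - c₀.im := by simp
    rw [e1, e2, ← sq, ← sq]
    linarith
  · -- a point of the segment in the square: the line `re = xs` at a height clamped to the segment
    set yy : ℝ := max (c₀.im - r / 2) (min (c₀.im + r / 2) (((q 1 : ℝ) + 1 / 2) * δ)) with hyy
    have hyy1 : c₀.im - r / 2 ≤ yy := le_max_left _ _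
    have hyy2 : yy ≤ c₀.im + r / 2 := max_le (by linarith) (min_le_left _ _)
    refine ⟨⟨xs, yy⟩, ?_, ?_⟩
    · refine ⟨(c₀.im + r / 2 - yy) / r, (yy - (c₀.im - r / 2)) / r, by positivity, by positivity, by field_simp; ring, ?_⟩
      apply Complex.ext <;> simp <;> field_simp <;> ring
    · obtain ⟨hx1, hx2, -, -⟩ := hx
      rw [hqeq] at hx1 hx2 ⊢
      refine ⟨by simpa using hx1, by simpa using hx2, ?_, ?_⟩ <;> simp only [Matrix.cons_val_one, Matrix.cons_val_fin_one]
      · show δ * (q 1 : ℝ) ≤ yy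
        rw [hyy]
        exact le_max_of_le_right (le_min (by linarith) (by nlinarith))
      · show yy ≤ δ * ((q 1 : ℝ) + 1)
        rw [hyy]
        exact max_le (by linarith) ((min_le_right _ _).trans (by nlinarith))

end KirchhoffSlope

end Summit.CriticalPhenomena.CardyFormulaZ2.Theorems
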